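import Literature.MathematicalPhysics.QuantumFieldTheory.Balaban1983to89.B9LocalLemma24TwoLevelCollarY
import Literature.MathematicalPhysics.QuantumFieldTheory.Balaban1983to89.B6SectALemma24TwoLevelV1SitesChart

/-!
# `Balaban1983to89.B9LocalLemma24TwoLevelCollarChartY` — T. Bałaban, *Propagators and renormalization transformations for lattice gauge theories. II*,
# Commun. Math. Phys. **96** (1984) 223–250 [Balaban1984PropagatorsII], (2.89) p. 239 «B^j(Λ) = □̃ ∩ B^{j+1}(Λ_{j+1})» with Lemma 2.4 (2.128) p. 245, read THROUGH A TORUS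
# CHART (p. 238 «T_□»): THE LOCAL LEMMA-2.4 LETTER (Rᴸ²⁴) ON THE REAL GAUGED CLASS `𝒯ᵣ(D)` OF A TWO-LEVEL SITE SET `D` FROM LEVEL GEOMETRY, FOR SITE SETS WRAPPING
# AROUND THE SEAM OF THE GLOBAL CHART — `B9LocalLemma24TwoLevelCollarY.local_lemma24_real_twoLevel_of_lev` with the label margins asked in the frame of p21's chart `s`

[Balaban1985BackgroundPropagators] = T. Bałaban, *Propagators for lattice gauge theories in a background field*, CMP **99** (1985) 389–434, p. 416 («In [4] we have
proved that the operator G_□(1) is positive»), p. 408 («□̃»); [4] = [Balaban1984PropagatorsII].  Statement-level skeleton with citation tags; proofs where landed;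
nothing here is a claim about the Yang–Mills mass gap.
THE PRINT (verbatim, [4] p. 239, (2.89)).  *«We define B^j(Λ) = □̃ ∩ B^{j+1}(Λ_{j+1}), (2.89) and we take Q′*aQ′, Q*aQ equal to Q′*_{j+1}a_{j+1}Q′_{j+1}, Q*_{j+1}a_{j+1}Q_{j+1}
on B^j(Λ), and to Q′*_ja_jQ′_j, Q*_ja_jQ_j on □̃ ∖ B^j(Λ)»*; p. 238: *«we take the cube □̃³ and identify it with a torus T_□»*; p. 224, (2.2): *«(L^jη)⁻¹ dist(Ω_j^c, Ω_{j+1}) > RM»*.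
WHY THIS FILE (cell context, 2026-08-28).  g25's `B9LocalLemma24TwoLevelCollarY.local_lemma24_real_twoLevel_of_lev` (p666756) produces C6's block sets `S`, `T` (with the
(2.89) collar) and their index facts from two LEVEL facts (`h2`, `hNbr2`) and passes the label margins `hmargS`∕`hmargT` («one big block off the box boundary») through to
dag-n10-c's `local_lemma24_real_twoLevel`; those margins FAIL for site sets meeting the seam of the global chart.  THIS FILE is the same construction feeding this seat's
chart transport `B6SectALemma24TwoLevelV1SitesChart.local_lemma24_real_twoLevel_chart` instead: ★★★ **`local_lemma24_real_twoLevel_of_lev_chart`** — g25's theorem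
VERBATIM except that `hmargS`∕`hmargT` are asked of the TRANSLATED labels `y − tv (tvec s) j`, `Y − tv (tvec s) (j+1)` of a chart `s : Fin (d+1) → ℤ` (`s = 0` is g25's).
g25's §0∕§1 lemmas (`stairSum_cornerV1_eq_zero_of_vanish`, `block_subset_of_witness`, `adj_blockOf_ends`, `iterBlockOf_succ_eq_blockOf`, `lamSite_blockOf_of_deep`) are used
BY NAME; the sibling file is forced by the 400-line cap (p666756 has 396 lines).  IMPORTS `B9LocalLemma24TwoLevelCollarY` (p666756), `B6SectALemma24TwoLevelV1SitesChart`
(this seat, g27); nothing restated.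
HONEST SCOPE.  Finite bookkeeping + transport of C6 through the chart; `h2`, `hNbr2` and the chart-frame margins are DISPLAYED geometric facts about `D` (for the enlarged
cubes `□̃(c)` all three are theorems of this seat's `B9LocalCubeGeometryTwoLevelWindowY` ∕ `B9LocalCubeGeometryChartY`); constants C6's, LEVEL-DEPENDENT; NOT a node discharge;
count-neutral; one finite 𝕋⁴ programme — nothing about the mass gap.  Cell `pub-ymgap` (D-0062), node N06 [B9] × N10 ROAD «C», seat `pub-ymgap-dag-n06-j` gen 27, 2026-08-28.
No `sorry`∕`axiom`∕`instance`∕`def`.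
-/

noncomputable section

namespace Literature.MathematicalPhysics.QuantumFieldTheory.Balaban1983to89.B9LocalLemma24TwoLevelCollarChartY

open Literature.MathematicalPhysics.QuantumFieldTheory.Balaban1983to89
open Literature.MathematicalPhysics.QuantumFieldTheory.Balaban1983to89.LatticeFieldCalculus (stairSum stairSum_self)
open Literature.MathematicalPhysics.QuantumFieldTheory.Balaban1983to89.B5Eq118OneStroke (iterBlock iterBlockOf mem_iterBlock mem_iterBlock_iff
  iterBlockOf_succ)
open Literature.MathematicalPhysics.QuantumFieldTheory.Balaban1983to89.B6SectALemma24OneLevelV1 (cornerV1 toZ toZ_cornerV1 cornerV1_mem_iterBlock)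
open Literature.MathematicalPhysics.QuantumFieldTheory.Balaban1983to89.B9LocalLemma24TwoLevelCollarY (stairSum_cornerV1_eq_zero_of_vanish block_subset_of_witness
  adj_blockOf_ends iterBlockOf_succ_eq_blockOf lamSite_blockOf_of_deep)
open Literature.MathematicalPhysics.QuantumFieldTheory.Balaban1983to89.B6SectALemma24TwoLevelV1SitesChart (local_lemma24_real_twoLevel_chart)
open Literature.MathematicalPhysics.QuantumFieldTheory.Balaban1983to89.B6TranslateV1 (tv)

section DefY

open Node00 B6KLevelCensusIndexV1 B6GlobalChartV1 B6MultiLevelTorusOperator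
open Literature.MathematicalPhysics.QuantumFieldTheory.Balaban1983to89.B6ScalarChartV1 (lamSite_domT_iff exists_iterBlockOf_eq)
open Literature.MathematicalPhysics.QuantumFieldTheory.Balaban1983to89.Node00.OpsYNablaBridge (chartY)
open Literature.MathematicalPhysics.QuantumFieldTheory.Balaban1983to89.B10StarCount (blockOf_shift)
open scoped Matrix

variable {d ℓ : ℕ} {hd : 1 ≤ d + 1} {hL : Odd (ℓ + 1) ∧ 1 < ℓ + 1} {b₀ b₁ : ℝ} (i : KIdx d ℓ hd hL b₀ b₁)

/-- ★★★ **THE LOCAL LEMMA-2.4 LETTER (Rᴸ²⁴) ON THE REAL GAUGED CLASS `𝒯ᵣ(D)` OF A TWO-LEVEL SITE SET FROM LEVEL GEOMETRY, THROUGH THE CHART `s` OF THE TORUS.**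
At def-Y's letters, `j + 1 ≤ k`, for a block-saturated site set `D` (`hD`) whose fine sites have levels in `{j, j+1}` (`h2`), such that NO site of level `≥ j+2` lies two
big-block steps around a big block meeting `D` (`hNbr2` — the collar of (2.2)), with the label margins of one big block off the box boundary IN THE FRAME OF p21's CHART `s`
(translation by `(M·L^k)·s`) for the `Λ_j`-blocks inside `D` (`hmargS`, labels `y − tv (tvec s) j`) and for the `Λ_{j+1}`-blocks one big-block step around a big block
meeting `D` (`hmargT`, labels `Y − tv (tvec s) (j+1)`) — so `D` MAY WRAP AROUND THE SEAM of the global chart —, and weights `≥ w₀ > 0`: every real bond field `v` with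
vanishing corner staircase sums on the member blocks inside `D` and vanishing on the bonds with both end points off `D` satisfies
**`κ₂·Σ_b v(b)² ≤ Σ_p ((curlK·v)(p))² + Σ_ι w(ι)·((qK·v)(ι))²`**, `κ₂ = (12(d+1)²(1 + 12(d+1)L^{2j}))⁻¹((L^{j+1})^{d+2})⁻¹·min(c_f²∕2, w₀∕(L^{j+1})^{d−1})` — g25's
construction of `S` (the `Λ_j`-blocks inside `D`) and `T` (the `Λ_{j+1}`-blocks inside `D` with the (2.89) collar) fed to `local_lemma24_real_twoLevel_chart`.
[cite: Balaban1984PropagatorsII, Lemma 2.4 (2.128) p.245, (2.89) p.239, p.238 (T_□), (2.121) p.244, (2.2)–(2.4) p.224; Balaban1985BackgroundPropagators, p.408 (□̃), p.416] -/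
theorem local_lemma24_real_twoLevel_of_lev_chart (hd2 : 2 ≤ d + 1) {j : ℕ} (hjk : j + 1 ≤ i.k) (D : Finset (SiteY i)) (s : Fin (d + 1) → ℤ)
    (hD : ∀ (j' : ℕ) (y : Site (PV d ℓ i.m i.K hd hL) j'), (domT i.hN i.D i.hk).LamSite j' y →
      (∀ x ∈ iterBlock j' y, chartY i x ∈ D) ∨ (∀ x ∈ iterBlock j' y, chartY i x ∉ D))
    (h2 : ∀ x : Site (PV d ℓ i.m i.K hd hL) 0, chartY i x ∈ D →
      i.D.lev (toBox i.hN x : Fin (d + 1) → ℤ) = j ∨ i.D.lev (toBox i.hN x : Fin (d + 1) → ℤ) = j + 1)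
    (hNbr2 : ∀ Y₀ Y₁ Y₂ : Site (PV d ℓ i.m i.K hd hL) (j + 1),
      (∃ x : Site (PV d ℓ i.m i.K hd hL) 0, iterBlockOf (j + 1) x = Y₀ ∧ chartY i x ∈ D) →
      (Y₁ = Y₀ ∨ ∃ μ, Y₁ = Y₀.shift μ ∨ Y₀ = Y₁.shift μ) → (Y₂ = Y₁ ∨ ∃ μ, Y₂ = Y₁.shift μ ∨ Y₁ = Y₂.shift μ) →
      ∀ y : Site (PV d ℓ i.m i.K hd hL) 0, iterBlockOf (j + 1) y = Y₂ → i.D.lev (toBox i.hN y : Fin (d + 1) → ℤ) ≤ j + 1)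
    (hmargS : ∀ y : Site (PV d ℓ i.m i.K hd hL) j, (domT i.hN i.D i.hk).LamSite j y → (∃ x ∈ iterBlock j y, chartY i x ∈ D) →
      ∀ μ, (ℓ + 1) ^ (j + 1) ≤ ((y - tv (PV d ℓ i.m i.K hd hL) (TDomains.tvec ℓ i.Mh i.k s) j) μ).val * (ℓ + 1) ^ j ∧
        ((y - tv (PV d ℓ i.m i.K hd hL) (TDomains.tvec ℓ i.Mh i.k s) j) μ).val * (ℓ + 1) ^ j + (ℓ + 1) ^ j + (ℓ + 1) ^ (j + 1) ≤ (PV d ℓ i.m i.K hd hL).sitesPerDir 0)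
    (hmargT : ∀ Y : Site (PV d ℓ i.m i.K hd hL) (j + 1), (domT i.hN i.D i.hk).LamSite (j + 1) Y →
      (∃ Y₀ : Site (PV d ℓ i.m i.K hd hL) (j + 1), (∃ x : Site (PV d ℓ i.m i.K hd hL) 0, iterBlockOf (j + 1) x = Y₀ ∧ chartY i x ∈ D) ∧
        (Y = Y₀ ∨ ∃ μ, Y = Y₀.shift μ ∨ Y₀ = Y.shift μ)) →
      ∀ μ, (ℓ + 1) ^ (j + 1) ≤ ((Y - tv (PV d ℓ i.m i.K hd hL) (TDomains.tvec ℓ i.Mh i.k s) (j + 1)) μ).val * (ℓ + 1) ^ (j + 1) ∧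
        ((Y - tv (PV d ℓ i.m i.K hd hL) (TDomains.tvec ℓ i.Mh i.k s) (j + 1)) μ).val * (ℓ + 1) ^ (j + 1) + 2 * (ℓ + 1) ^ (j + 1) ≤ (PV d ℓ i.m i.K hd hL).sitesPerDir 0)
    {w₀ : ℝ} (hw₀ : 0 < w₀) (hw : ∀ ι : IBondY i, w₀ ≤ i.w ι) (v : FBondY i → ℝ)
    (hst : ∀ (j' : ℕ) (y : Site (PV d ℓ i.m i.K hd hL) j'), (domT i.hN i.D i.hk).LamSite j' y → (∀ x ∈ iterBlock j' y, chartY i x ∈ D) →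
      ∀ x ∈ iterBlock j' y, stairSum v (cornerV1 j' y) x = 0)
    (hoff : ∀ b : FBondY i, chartY i b.src ∉ D → chartY i b.tgt ∉ D → v b = 0) :
    (12 * (((d + 1 : ℕ) : ℝ)) ^ 2 * (1 + 12 * (((d + 1 : ℕ) : ℝ)) * ((((ℓ + 1 : ℕ) : ℝ)) ^ j) ^ 2))⁻¹ *
          (((((ℓ + 1 : ℕ) : ℝ)) ^ (j + 1)) ^ (d + 1 + 1))⁻¹ * min (i.cf ^ 2 / 2) (w₀ / ((((ℓ + 1 : ℕ) : ℝ)) ^ (j + 1)) ^ (d + 1 - 2)) *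
        ∑ b, v b ^ 2 ≤
      ∑ p, (curlK i *ᵥ v) p ^ 2 + ∑ ι, i.w ι * (qK i *ᵥ v) ι ^ 2 := by
  classical
  have hjm : j + 1 ≤ i.m + i.K := hjk.trans i.hk
  have hjm0 : j ≤ i.m + i.K := (Nat.le_succ j).trans hjm
  -- the two block sets
  set S : Finset (Site (PV d ℓ i.m i.K hd hL) j) :=
    Finset.univ.filter fun y => (domT i.hN i.D i.hk).LamSite j y ∧ ∃ x ∈ iterBlock j y, chartY i x ∈ D with hSdef
  set T : Finset (Site (PV d ℓ i.m i.K hd hL) (j + 1)) :=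
    Finset.univ.filter fun Y => (domT i.hN i.D i.hk).LamSite (j + 1) Y ∧
      ((∃ x ∈ iterBlock (j + 1) Y, chartY i x ∈ D) ∨
        ∃ bb : PBond (PV d ℓ i.m i.K hd hL) j, (blockOf bb.src = Y ∨ blockOf bb.tgt = Y) ∧
          ∃ y₀ : Site (PV d ℓ i.m i.K hd hL) 0, (iterBlockOf j y₀ = bb.src ∨ iterBlockOf j y₀ = bb.tgt) ∧ chartY i y₀ ∈ D ∧
            i.D.lev (toBox i.hN y₀ : Fin (d + 1) → ℤ) = j) with hTdef
  have hS : ∀ {y}, y ∈ S ↔ _ := fun {y} => by rw [hSdef, Finset.mem_filter, and_iff_right (Finset.mem_univ _)]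
  have hT : ∀ {Y}, Y ∈ T ↔ _ := fun {Y} => by rw [hTdef, Finset.mem_filter, and_iff_right (Finset.mem_univ _)]
  -- every block of `T` is EQUAL OR ADJACENT to a big block meeting `D`
  have hTadj : ∀ Y ∈ T, ∃ Y₀ : Site (PV d ℓ i.m i.K hd hL) (j + 1),
      (∃ x : Site (PV d ℓ i.m i.K hd hL) 0, iterBlockOf (j + 1) x = Y₀ ∧ chartY i x ∈ D) ∧ (Y = Y₀ ∨ ∃ μ, Y = Y₀.shift μ ∨ Y₀ = Y.shift μ) := by
    intro Y hY
    obtain ⟨-, hin | ⟨bb, hbY, y₀, hy₀, hD₀, -⟩⟩ := hT.1 hY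
    · obtain ⟨x, hx, hxD⟩ := hin
      exact ⟨Y, ⟨x, (mem_iterBlock _ _ _).1 hx, hxD⟩, Or.inl rfl⟩
    · -- the collar case: `Y` is the big block of an end `z` of `bb`, `y₀` lies under an end `e` of `bb`
      obtain ⟨z, hz, hzY⟩ : ∃ z : Site (PV d ℓ i.m i.K hd hL) j, (z = bb.src ∨ z = bb.tgt) ∧ blockOf z = Y := by
        rcases hbY with h | h; exacts [⟨bb.src, Or.inl rfl, h⟩, ⟨bb.tgt, Or.inr rfl, h⟩]
      obtain ⟨e, he, hy₀e⟩ : ∃ e : Site (PV d ℓ i.m i.K hd hL) j, (e = bb.src ∨ e = bb.tgt) ∧ iterBlockOf j y₀ = e := by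
        rcases hy₀ with h | h; exacts [⟨bb.src, Or.inl rfl, h⟩, ⟨bb.tgt, Or.inr rfl, h⟩]
      refine ⟨blockOf e, ⟨y₀, iterBlockOf_succ_eq_blockOf i hy₀e, hD₀⟩, ?_⟩
      rw [← hzY]
      exact adj_blockOf_ends i hjm bb he hz
  -- (hST): a `Λ_j`-site is not under a `Λ_{j+1}`-site (the partition (2.4))
  have hST : ∀ y ∈ S, blockOf y ∉ T := by
    intro y hy hyT
    have hlam := (hS.1 hy).1
    have hlam' := (hT.1 hyT).1
    obtain ⟨x, hx⟩ := exists_iterBlockOf_eq (hd := hd) (hL := hL) hjm0 y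
    rw [← hx] at hlam
    rw [← iterBlockOf_succ_eq_blockOf i hx] at hlam'
    exact absurd ((domT i.hN i.D i.hk).lamSite_iterBlockOf_unique hlam hlam') (by omega)
  -- (hIS): the index facts at scale `j`
  have hIS : ∀ bb : PBond (PV d ℓ i.m i.K hd hL) j, (bb.src ∈ S ∨ bb.tgt ∈ S) → blockOf bb.src ∉ T → blockOf bb.tgt ∉ T →
      (domT i.hN i.D i.hk).LamBond j bb := by
    intro bb hS' hsT htT
    -- the end `e ∈ S` and the other end `z`
    have key : ∀ e z : Site (PV d ℓ i.m i.K hd hL) j, (e = bb.src ∨ e = bb.tgt) → (z = bb.src ∨ z = bb.tgt) → e ∈ S →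
        ¬ (domT i.hN i.D i.hk).Deep j z := by
      intro e z he hz heS hdeep
      have hzT : blockOf z ∉ T := by rcases hz with rfl | rfl <;> assumption
      obtain ⟨hlamz, hlevz⟩ := lamSite_blockOf_of_deep i hjk D hNbr2 bb he hz (hS.1 heS) hdeep
      refine hzT (hT.2 ⟨hlamz, Or.inr ⟨bb, ?_, ?_⟩⟩)
      · rcases hz with rfl | rfl; exacts [Or.inl rfl, Or.inr rfl]
      · obtain ⟨hlame, x₀, hx₀, hD₀⟩ := hS.1 heS
        have hx₀e : iterBlockOf j x₀ = e := (mem_iterBlock j e x₀).1 hx₀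
        refine ⟨x₀, ?_, hD₀, ?_⟩
        · rcases he with rfl | rfl; exacts [Or.inl hx₀e, Or.inr hx₀e]
        · rw [← hx₀e] at hlame
          exact (lamSite_domT_iff i.hN i.D i.hk j x₀).1 hlame
    rcases hS' with h | h
    · have hlam := (hS.1 h).1
      exact ⟨Or.inl hlam.1, hlam.2, key bb.src bb.tgt (Or.inl rfl) (Or.inr rfl) h⟩
    · have hlam := (hS.1 h).1
      exact ⟨Or.inr hlam.1, key bb.tgt bb.src (Or.inr rfl) (Or.inl rfl) h, hlam.2⟩
  -- (hIB): the index facts at scale `j+1`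
  have hIB : ∀ BB : PBond (PV d ℓ i.m i.K hd hL) (j + 1), (BB.src ∈ T ∨ BB.tgt ∈ T) → (domT i.hN i.D i.hk).LamBond (j + 1) BB := by
    intro BB hBT
    have key : ∀ Y Z : Site (PV d ℓ i.m i.K hd hL) (j + 1), (Y = BB.src ∨ Y = BB.tgt) → (Z = BB.src ∨ Z = BB.tgt) → Y ∈ T →
        ¬ (domT i.hN i.D i.hk).Deep (j + 1) Z := by
      intro Y Z hY hZ hYT hdeep
      by_cases hk2 : i.k ≤ j + 1
      · exact (domT i.hN i.D i.hk).not_deep_of_le (show (domT i.hN i.D i.hk).k ≤ j + 1 from hk2) Z hdeep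
      · have hk2' : j + 1 + 1 ≤ i.k := by omega
        have hjm2 : j + 1 ≤ i.m + i.K := hjm
        obtain ⟨y, hy⟩ := exists_iterBlockOf_eq (hd := hd) (hL := hL) hjm2 Z
        have hge : j + 1 + 1 ≤ i.D.lev (toBox i.hN y : Fin (d + 1) → ℤ) := by
          refine (iterBlockOf_mem_domT_iff i.hN i.D i.hk (by omega) hk2' y).1 ?_
          rw [iterBlockOf_succ_eq_blockOf i hy]; exact hdeep
        obtain ⟨Y₀, hY₀, hadj⟩ := hTadj Y hYT
        have hadj' : Z = Y ∨ ∃ μ, Z = Y.shift μ ∨ Y = Z.shift μ := by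
          rcases hY with rfl | rfl <;> rcases hZ with rfl | rfl
          · exact Or.inl rfl
          · exact Or.inr ⟨BB.dir, Or.inl rfl⟩
          · exact Or.inr ⟨BB.dir, Or.inr rfl⟩
          · exact Or.inl rfl
        have hle := hNbr2 Y₀ Y Z hY₀ hadj hadj' y hy
        omega
    rcases hBT with h | h
    · have hlam := (hT.1 h).1
      exact ⟨Or.inl hlam.1, hlam.2, key BB.src BB.tgt (Or.inl rfl) (Or.inr rfl) h⟩
    · have hlam := (hT.1 h).1
      exact ⟨Or.inr hlam.1, key BB.tgt BB.src (Or.inr rfl) (Or.inl rfl) h, hlam.2⟩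
  -- the label margins
  have hboxS : ∀ y ∈ S, ∀ μ, (ℓ + 1) ^ (j + 1) ≤ ((y - tv (PV d ℓ i.m i.K hd hL) (TDomains.tvec ℓ i.Mh i.k s) j) μ).val * (ℓ + 1) ^ j ∧
      ((y - tv (PV d ℓ i.m i.K hd hL) (TDomains.tvec ℓ i.Mh i.k s) j) μ).val * (ℓ + 1) ^ j + (ℓ + 1) ^ j + (ℓ + 1) ^ (j + 1) ≤ (PV d ℓ i.m i.K hd hL).sitesPerDir 0 := fun y hy =>
    hmargS y (hS.1 hy).1 (hS.1 hy).2
  have hboxT : ∀ Y ∈ T, ∀ μ, (ℓ + 1) ^ (j + 1) ≤ ((Y - tv (PV d ℓ i.m i.K hd hL) (TDomains.tvec ℓ i.Mh i.k s) (j + 1)) μ).val * (ℓ + 1) ^ (j + 1) ∧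
      ((Y - tv (PV d ℓ i.m i.K hd hL) (TDomains.tvec ℓ i.Mh i.k s) (j + 1)) μ).val * (ℓ + 1) ^ (j + 1) + 2 * (ℓ + 1) ^ (j + 1) ≤ (PV d ℓ i.m i.K hd hL).sitesPerDir 0 := fun Y hY =>
    hmargT Y (hT.1 hY).1 (hTadj Y hY)
  -- `v` is carried by the bonds meeting the blocks of `S` and `T`
  have hoff' : ∀ b : FBondY i, v b ≠ 0 →
      (∃ y ∈ S, b.src ∈ iterBlock j y ∨ b.tgt ∈ iterBlock j y) ∨ (∃ Y ∈ T, b.src ∈ iterBlock (j + 1) Y ∨ b.tgt ∈ iterBlock (j + 1) Y) := by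
    intro b hb
    -- an end point `e` of `b` lies in `D`
    obtain ⟨e, he, heD⟩ : ∃ e : Site (PV d ℓ i.m i.K hd hL) 0, (e = b.src ∨ e = b.tgt) ∧ chartY i e ∈ D := by
      by_contra h
      push Not at h
      exact hb (hoff b (h b.src (Or.inl rfl)) (h b.tgt (Or.inr rfl)))
    have hmem : ∀ (j' : ℕ) (Y : Site (PV d ℓ i.m i.K hd hL) j'), iterBlockOf j' e = Y → b.src ∈ iterBlock j' Y ∨ b.tgt ∈ iterBlock j' Y := by
      intro j' Y hY
      rcases he with rfl | rfl
      · exact Or.inl ((mem_iterBlock _ _ _).2 hY)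
      · exact Or.inr ((mem_iterBlock _ _ _).2 hY)
    rcases h2 e heD with hl | hl
    · refine Or.inl ⟨iterBlockOf j e, hS.2 ⟨(lamSite_domT_iff i.hN i.D i.hk j e).2 hl, e, (mem_iterBlock _ _ _).2 rfl, heD⟩, hmem j _ rfl⟩
    · refine Or.inr ⟨iterBlockOf (j + 1) e, hT.2 ⟨(lamSite_domT_iff i.hN i.D i.hk (j + 1) e).2 hl, Or.inl ⟨e, (mem_iterBlock _ _ _).2 rfl, heD⟩⟩,
        hmem (j + 1) _ rfl⟩
  -- staircase sums on the blocks of `S` (inside `D`: the class) and of `T` (inside `D`: the class; off `D`: `v` vanishes inside)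
  have hTs : ∀ y ∈ S, ∀ x ∈ iterBlock j y, stairSum v (cornerV1 j y) x = 0 := fun y hy =>
    hst j y (hS.1 hy).1 (block_subset_of_witness i D hD (hS.1 hy).1 (hS.1 hy).2)
  have hTb : ∀ Y ∈ T, ∀ x ∈ iterBlock (j + 1) Y, stairSum v (cornerV1 (j + 1) Y) x = 0 := by
    intro Y hY
    have hlam := (hT.1 hY).1
    by_cases hin : ∃ x ∈ iterBlock (j + 1) Y, chartY i x ∈ D
    · exact hst (j + 1) Y hlam (block_subset_of_witness i D hD hlam hin)
    · push Not at hin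
      exact stairSum_cornerV1_eq_zero_of_vanish (P := PV d ℓ i.m i.K hd hL) hjm v Y fun b hs ht => hoff b (hin _ hs) (hin _ ht)
  exact local_lemma24_real_twoLevel_chart i hd2 (show j + 1 ≤ (domT i.hN i.D i.hk).k from hjk) s S T hST hboxS hboxT hIS hIB hw₀ hw v hoff' hTs hTb

end DefY

end Literature.MathematicalPhysics.QuantumFieldTheory.Balaban1983to89.B9LocalLemma24TwoLevelCollarChartY

end
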